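/-
  Summits/AtomisticToContinuum/Crystallization/Theorems/OverbindingBudgetAffineFarKissingRigidity.lean

  residual stmt-AtomisticToContinuum-31280 · slot Z `FarAggregatePricing 12 (1/25) (1/2000) (1/(2·10⁷))` · leaf LAB₁′ `ShelteredShellLabelling'`
  (leaf list v14′, critic row 890; engine LAB₁′ ⟸ R_aff′ ∧ BBI ∧ CORE ∧ PCR₁ of the g56 sketch): ★ PCR₁ `KissingRelabellingRigidity (1/11)`
  PROVED OUTRIGHT (critic row 890: "file PCR₁ as S support item" — this file closes it).  Part 2 of 2 (part 1 = `…FarFrameLattice`).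
  decomp-a2c lens-4 «minimal counterexample / extremal reduction», generation 57.  0 sorry · 0 axiom · no instance · no notation · no option.
-/
import Summits.AtomisticToContinuum.Crystallization.Theorems.OverbindingBudgetAffineFarFrameLattice

/-! # PCR₁ — rigidity of near-linear relabellings of a kissing configuration (PROVED)

THE STATEMENT.  `KissingRelabellingRigidity η₀` (typed verbatim in the g56 engine sketch, item PCR₁): a map `g` of the twelve touching
neighbours `barlowShell σ τ` of a site of a close-packed stacking (unit spacing, letters `σ, τ = ±1`) INTO a rotated kissing configuration
`V '' barlowShell σ' τ'` (`V` a linear isometry, any letters) that is `η₀`-close on the shell to SOME linear map `T` is the restriction of a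
linear isometry `U`.  PROVED for `108 η₀² < 1`, in particular `η₀ = 1/11` (`kissingRelabellingRigidity_eleventh`); the injectivity
hypothesis of PCR₁ is not used (`barlowShell_relabelling_rigidity`).  In the LAB₁′ engine this is the E5 kernel: the relabelled first
shell of a good site is a kissing configuration of the same type up to a rotation, and the site's affine fit may be taken to be a rotation.

THE PROOF (at Hales's scale `layerShell σ τ = 2·barlowShell σ τ`, `G = 2 g(½·)`, `η = 2η₀`, `27 η² < 1`; tool-box `…FarFrameLattice`).
* NINE SHORT RELATIONS SURVIVE (`…FarFrameLattice` §3: an integer relation `Σ cᵢ xᵢ = 0` with `Σ|cᵢ| ≤ 6` forces `Σ cᵢ G xᵢ = 0`, because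
  the latter is the `V`-image of a vector of the frame lattice `Λ` of norm `≤ 6η < 2/√3`): the antipodes `−u₁ + u₁`, `−u₂ + u₂`,
  `(u₂ − u₁) + (u₁ − u₂)`, the hexagon relation `(u₁ − u₂) − u₁ + u₂`, the four relations `(σ(w − uᵢ) + 𝗁e₃) − (σw + 𝗁e₃) + σuᵢ` (upper; lower
  with `τ, −𝗁e₃`), and the six-term relation "upper triple + lower triple = 0" (`3w = u₁ + u₂`).
* LINEAR EXTENSION.  Hence `G` agrees on all twelve points with the linear map taking the basis `(u₁, u₂, σw + 𝗁e₃)` to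
  `(G u₁, G u₂, G(σw + 𝗁e₃))` (`extensionMap`).
* ISOMETRY.  The Gram matrix of the three images equals that of the basis (`4` on the diagonal, `2, 2σ, 2σ` off it: norms `‖G x‖ = 2`,
  inner products from `‖G(u₁ − u₂)‖ = ‖G(σ(w − uᵢ) + 𝗁e₃)‖ = 2` and the relations), so the extension is a linear isometry.
HIDDEN-GAUGE / DEGENERATE AUDIT: `T` enters only through `T(Σcᵢxᵢ) = 0` (any linear `T`, no invertibility, no closeness of `T` to `V`);
`V` only through linearity and `‖Vz‖ = ‖z‖`; `σ', τ'` only through `layerShell σ' τ' ⊆ Λ ∩ S²(2)`; the threshold is where the method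
stops (`6η < 2/√3`), the typed constant `1/11` is inside it (`108/121 < 1`); no labels, no `N`, no choice beyond the twelve preimages.
-/

namespace Summit.AtomisticToContinuum.Crystallization.Theorems.OverbindingBudgetAffineFarSmoothSplit

open scoped BigOperators RealInnerProductSpace
open Literature.MathematicalPhysics.StatisticalMechanics
open Literature.Geometry.DiscreteGeometry (layerSpacing layerShell hexagonSet holeTriple mem_layerShell_iff hexagonSet_subset_layerShell
  mem_holeTriple_iff mem_holeTriple_one_iff frameW_eq inner_frameU_frameU inner_frameV_frameV inner_frameU_frameV inner_frameU_frameE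
  inner_frameV_frameE inner_frameE_frameE inner_frameU_frameW inner_frameV_frameW inner_frameW_frameW inner_frameW_frameE inner_frameE_frameW)

/-! ## §0  The statement PCR₁ (verbatim from the g56 engine sketch `bc/EngineSketch.lean`) -/

/-- **PCR₁ · `KissingRelabellingRigidity η₀`** (GENERIC · one parameter): a map `g` of the kissing configuration `barlowShell σ τ`
(`σ, τ = ±1`) into a rotated kissing configuration `V '' barlowShell σ' τ'`, injective and `η₀`-close on the shell to a linear map `T`, is
the restriction of a linear isometry.  PROVED for `108 η₀² < 1` (`kissingRelabellingRigidity_of_sq_lt`), in particular for `η₀ = 1/11`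
(`kissingRelabellingRigidity_eleventh`); injectivity is not needed (`barlowShell_relabelling_rigidity`). [this file] -/
def KissingRelabellingRigidity (η₀ : ℝ) : Prop :=
  ∀ (σ τ σ' τ' : ℝ), (σ = 1 ∨ σ = -1) → (τ = 1 ∨ τ = -1) → (σ' = 1 ∨ σ' = -1) → (τ' = 1 ∨ τ' = -1) →
    ∀ (V : EuclideanSpace ℝ (Fin 3) →ₗᵢ[ℝ] EuclideanSpace ℝ (Fin 3)) (T : EuclideanSpace ℝ (Fin 3) →ₗ[ℝ] EuclideanSpace ℝ (Fin 3))
      (g : EuclideanSpace ℝ (Fin 3) → EuclideanSpace ℝ (Fin 3)),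
      Set.MapsTo g (barlowShell σ τ) (V '' barlowShell σ' τ') → Set.InjOn g (barlowShell σ τ) →
        (∀ x ∈ barlowShell σ τ, ‖g x - T x‖ ≤ η₀) →
          ∃ U : EuclideanSpace ℝ (Fin 3) →ₗᵢ[ℝ] EuclideanSpace ℝ (Fin 3), ∀ x ∈ barlowShell σ τ, g x = U x

/-! ## §5  ★ Rigidity at Hales scale, and PCR₁ (PROVED) -/

/-- Equality of labels from a two-term relation (see `rel₂`). [this file] -/
private theorem eq_of_rel₂ {X Y : EuclideanSpace ℝ (Fin 3)} (h : (1 : ℝ) • X + (1 : ℝ) • Y = 0) : X = -Y := by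
  rw [one_smul, one_smul] at h
  exact eq_neg_of_add_eq_zero_left h

/-- Equality of labels from a three-term relation (see `rel₃`). [this file] -/
private theorem eq_of_rel₃ {X Y Z : EuclideanSpace ℝ (Fin 3)} {c : ℝ} (h : (1 : ℝ) • X + (-1 : ℝ) • Y + c • Z = 0) :
    X = Y - c • Z := by
  rw [← sub_eq_zero, ← h]
  module

/-- ★ **RIGIDITY OF NEAR-LINEAR RELABELLINGS, Hales scale (PROVED).** A map `G` of `layerShell σ τ` into `V '' layerShell σ' τ'`
(`V` a linear isometry; all letters `±1`) which is `η`-close on the shell to a linear map `T`, `27η² < 1`, is the restriction of a linear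
isometry — namely of the linear extension of `G` from the basis `(u₁, u₂, σw + 𝗁e₃)`. [this file] -/
theorem layerShell_relabelling_rigidity {σ τ σ' τ' : ℝ} (hσ : σ = 1 ∨ σ = -1) (hτ : τ = 1 ∨ τ = -1)
    (hσ' : σ' = 1 ∨ σ' = -1) (hτ' : τ' = 1 ∨ τ' = -1)
    (V : EuclideanSpace ℝ (Fin 3) →ₗᵢ[ℝ] EuclideanSpace ℝ (Fin 3)) (T : EuclideanSpace ℝ (Fin 3) →ₗ[ℝ] EuclideanSpace ℝ (Fin 3))
    (G : EuclideanSpace ℝ (Fin 3) → EuclideanSpace ℝ (Fin 3)) {η : ℝ}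
    (hmaps : Set.MapsTo G (layerShell σ τ) (V '' layerShell σ' τ'))
    (hclose : ∀ x ∈ layerShell σ τ, ‖G x - T x‖ ≤ η) (hη : 27 * η ^ 2 < 1) :
    ∃ U : EuclideanSpace ℝ (Fin 3) →ₗᵢ[ℝ] EuclideanSpace ℝ (Fin 3), ∀ x ∈ layerShell σ τ, G x = U x := by
  have hσ2 : σ * σ = 1 := by rcases hσ with rfl | rfl <;> norm_num
  -- names for the six hole vectors (the hexagon vectors are written out)
  obtain ⟨h₁, hh₁⟩ : ∃ y : EuclideanSpace ℝ (Fin 3), y = σ • barlowOffset (2 : ℝ) + layerNormal layerSpacing := ⟨_, rfl⟩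
  obtain ⟨h₂, hh₂⟩ : ∃ y : EuclideanSpace ℝ (Fin 3),
    y = σ • (barlowOffset (2 : ℝ) - triangularVec₁ (2 : ℝ)) + layerNormal layerSpacing := ⟨_, rfl⟩
  obtain ⟨h₃, hh₃⟩ : ∃ y : EuclideanSpace ℝ (Fin 3),
    y = σ • (barlowOffset (2 : ℝ) - triangularVec₂ (2 : ℝ)) + layerNormal layerSpacing := ⟨_, rfl⟩
  obtain ⟨l₁, hl₁⟩ : ∃ y : EuclideanSpace ℝ (Fin 3), y = τ • barlowOffset (2 : ℝ) - layerNormal layerSpacing := ⟨_, rfl⟩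
  obtain ⟨l₂, hl₂⟩ : ∃ y : EuclideanSpace ℝ (Fin 3),
    y = τ • (barlowOffset (2 : ℝ) - triangularVec₁ (2 : ℝ)) - layerNormal layerSpacing := ⟨_, rfl⟩
  obtain ⟨l₃, hl₃⟩ : ∃ y : EuclideanSpace ℝ (Fin 3),
    y = τ • (barlowOffset (2 : ℝ) - triangularVec₂ (2 : ℝ)) - layerNormal layerSpacing := ⟨_, rfl⟩
  -- the twelve memberships
  have upmem : ∀ t ∈ holeTriple σ, t + layerNormal layerSpacing ∈ layerShell σ τ := fun t ht =>
    mem_layerShell_iff.2 (Or.inr (Or.inl (by rwa [add_sub_cancel_right])))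
  have dnmem : ∀ t ∈ holeTriple τ, t - layerNormal layerSpacing ∈ layerShell σ τ := fun t ht =>
    mem_layerShell_iff.2 (Or.inr (Or.inr (by rwa [sub_add_cancel])))
  have m_u : triangularVec₁ (2 : ℝ) ∈ layerShell σ τ := hexagonSet_subset_layerShell _ _ (by simp [hexagonSet])
  have m_nu : -triangularVec₁ (2 : ℝ) ∈ layerShell σ τ := hexagonSet_subset_layerShell _ _ (by simp [hexagonSet])
  have m_v : triangularVec₂ (2 : ℝ) ∈ layerShell σ τ := hexagonSet_subset_layerShell _ _ (by simp [hexagonSet])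
  have m_nv : -triangularVec₂ (2 : ℝ) ∈ layerShell σ τ := hexagonSet_subset_layerShell _ _ (by simp [hexagonSet])
  have m_uv : triangularVec₁ (2 : ℝ) - triangularVec₂ (2 : ℝ) ∈ layerShell σ τ :=
    hexagonSet_subset_layerShell _ _ (by simp [hexagonSet])
  have m_vu : triangularVec₂ (2 : ℝ) - triangularVec₁ (2 : ℝ) ∈ layerShell σ τ :=
    hexagonSet_subset_layerShell _ _ (by simp [hexagonSet])
  have m_h1 : h₁ ∈ layerShell σ τ := by rw [hh₁]; exact upmem _ (by simp [holeTriple])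
  have m_h2 : h₂ ∈ layerShell σ τ := by rw [hh₂]; exact upmem _ (by simp [holeTriple])
  have m_h3 : h₃ ∈ layerShell σ τ := by rw [hh₃]; exact upmem _ (by simp [holeTriple])
  have m_l1 : l₁ ∈ layerShell σ τ := by rw [hl₁]; exact dnmem _ (by simp [holeTriple])
  have m_l2 : l₂ ∈ layerShell σ τ := by rw [hl₂]; exact dnmem _ (by simp [holeTriple])
  have m_l3 : l₃ ∈ layerShell σ τ := by rw [hl₃]; exact dnmem _ (by simp [holeTriple])
  -- §3: the nine preserved relations
  have E1 : G (-triangularVec₁ (2 : ℝ)) = -G (triangularVec₁ (2 : ℝ)) :=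
    eq_of_rel₂ (rel₂ hσ' hτ' V T G hmaps hclose m_nu m_u (by module) hη)
  have E2 : G (-triangularVec₂ (2 : ℝ)) = -G (triangularVec₂ (2 : ℝ)) :=
    eq_of_rel₂ (rel₂ hσ' hτ' V T G hmaps hclose m_nv m_v (by module) hη)
  have E3 : G (triangularVec₁ (2 : ℝ) - triangularVec₂ (2 : ℝ)) = G (triangularVec₁ (2 : ℝ)) - G (triangularVec₂ (2 : ℝ)) := by
    have h := eq_of_rel₃ (rel₃ hσ' hτ' V T G hmaps hclose (Or.inl rfl) m_uv m_u m_v (by module) hη)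
    rwa [one_smul] at h
  have E4 : G (triangularVec₂ (2 : ℝ) - triangularVec₁ (2 : ℝ)) = G (triangularVec₂ (2 : ℝ)) - G (triangularVec₁ (2 : ℝ)) := by
    rw [eq_of_rel₂ (rel₂ hσ' hτ' V T G hmaps hclose m_vu m_uv (by module) hη), E3]
    abel
  have E5 : G h₂ = G h₁ - σ • G (triangularVec₁ (2 : ℝ)) :=
    eq_of_rel₃ (rel₃ hσ' hτ' V T G hmaps hclose hσ m_h2 m_h1 m_u (by rw [hh₂, hh₁]; module) hη)
  have E6 : G h₃ = G h₁ - σ • G (triangularVec₂ (2 : ℝ)) :=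
    eq_of_rel₃ (rel₃ hσ' hτ' V T G hmaps hclose hσ m_h3 m_h1 m_v (by rw [hh₃, hh₁]; module) hη)
  have E7 : G l₂ = G l₁ - τ • G (triangularVec₁ (2 : ℝ)) :=
    eq_of_rel₃ (rel₃ hσ' hτ' V T G hmaps hclose hτ m_l2 m_l1 m_u (by rw [hl₂, hl₁]; module) hη)
  have E8 : G l₃ = G l₁ - τ • G (triangularVec₂ (2 : ℝ)) :=
    eq_of_rel₃ (rel₃ hσ' hτ' V T G hmaps hclose hτ m_l3 m_l1 m_v (by rw [hl₃, hl₁]; module) hη)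
  have S6 : G h₁ + G h₂ + G h₃ + G l₁ + G l₂ + G l₃ = 0 :=
    rel₆ hσ' hτ' V T G hmaps hclose m_h1 m_h2 m_h3 m_l1 m_l2 m_l3
      (by rw [hh₁, hh₂, hh₃, hl₁, hl₂, hl₃, frameW_eq]; module) hη
  have E9 : G l₁ = ((σ + τ) / 3) • (G (triangularVec₁ (2 : ℝ)) + G (triangularVec₂ (2 : ℝ))) - G h₁ := by
    have h3 : (3 : ℝ) • (G l₁ - (((σ + τ) / 3) • (G (triangularVec₁ (2 : ℝ)) + G (triangularVec₂ (2 : ℝ))) - G h₁)) =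
        G h₁ + G h₂ + G h₃ + G l₁ + G l₂ + G l₃ := by
      rw [E5, E6, E7, E8]; module
    rw [S6, smul_eq_zero] at h3
    rcases h3 with h3 | h3
    · norm_num at h3
    · exact sub_eq_zero.mp h3
  -- every shell vector has coordinates `(a, b, c)` in the basis `(u₁, u₂, h₁)` with `G x = a G u₁ + b G u₂ + c G h₁`
  have coeffs : ∀ x ∈ layerShell σ τ, ∃ a b c : ℝ,
      x = a • triangularVec₁ (2 : ℝ) + b • triangularVec₂ (2 : ℝ) + c • h₁ ∧
        G x = a • G (triangularVec₁ (2 : ℝ)) + b • G (triangularVec₂ (2 : ℝ)) + c • G h₁ := by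
    intro x hx
    rw [mem_layerShell_iff] at hx
    rcases hx with hx | hx | hx
    · simp only [hexagonSet, Set.mem_insert_iff, Set.mem_singleton_iff] at hx
      rcases hx with rfl | rfl | rfl | rfl | rfl | rfl
      · exact ⟨1, 0, 0, by module, by module⟩
      · exact ⟨-1, 0, 0, by module, by rw [E1]; module⟩
      · exact ⟨0, 1, 0, by module, by module⟩
      · exact ⟨0, -1, 0, by module, by rw [E2]; module⟩
      · exact ⟨1, -1, 0, by module, by rw [E3]; module⟩
      · exact ⟨-1, 1, 0, by module, by rw [E4]; module⟩
    · obtain ⟨p, hp, hxp⟩ := mem_holeTriple_iff.1 hx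
      have hx' : x = σ • p + layerNormal layerSpacing := by rw [← hxp, sub_add_cancel]
      subst hx'
      rw [mem_holeTriple_one_iff] at hp
      rcases hp with rfl | rfl | rfl
      · rw [← hh₁]
        exact ⟨0, 0, 1, by module, by module⟩
      · rw [← hh₂]
        exact ⟨-σ, 0, 1, by rw [hh₂, hh₁]; module, by rw [E5]; module⟩
      · rw [← hh₃]
        exact ⟨0, -σ, 1, by rw [hh₃, hh₁]; module, by rw [E6]; module⟩
    · obtain ⟨p, hp, hxp⟩ := mem_holeTriple_iff.1 hx
      have hx' : x = τ • p - layerNormal layerSpacing := by rw [← hxp, add_sub_cancel_right]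
      subst hx'
      rw [mem_holeTriple_one_iff] at hp
      rcases hp with rfl | rfl | rfl
      · rw [← hl₁]
        exact ⟨(σ + τ) / 3, (σ + τ) / 3, -1, by rw [hl₁, hh₁, frameW_eq]; module, by rw [E9]; module⟩
      · rw [← hl₂]
        exact ⟨(σ + τ) / 3 - τ, (σ + τ) / 3, -1, by rw [hl₂, hh₁, frameW_eq]; module, by rw [E7, E9]; module⟩
      · rw [← hl₃]
        exact ⟨(σ + τ) / 3, (σ + τ) / 3 - τ, -1, by rw [hl₃, hh₁, frameW_eq]; module, by rw [E8, E9]; module⟩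
  -- §4: the Gram matrix of `(G u₁, G u₂, G h₁)` is that of `(u₁, u₂, h₁)`
  have hn2 : ∀ x ∈ layerShell σ τ, ⟪G x, G x⟫ = 4 := fun x hx => by
    obtain ⟨y, hy, hyx⟩ := hmaps hx
    rw [real_inner_self_eq_norm_sq, ← hyx, V.norm_map, norm_eq_two_of_mem_layerShell hσ' hτ' hy]
    norm_num
  have gUU := hn2 _ m_u
  have gVV := hn2 _ m_v
  have gHH := hn2 _ m_h1
  have gUV : ⟪G (triangularVec₁ (2 : ℝ)), G (triangularVec₂ (2 : ℝ))⟫ = 2 := by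
    have h := hn2 _ m_uv
    rw [E3, real_inner_sub_sub_self, gUU, gVV] at h
    linarith
  have gUH : ⟪G (triangularVec₁ (2 : ℝ)), G h₁⟫ = 2 * σ := by
    have h := hn2 _ m_h2
    rw [E5, real_inner_sub_sub_self] at h
    simp only [real_inner_smul_left, real_inner_smul_right] at h
    rw [gHH, gUU, real_inner_comm (G (triangularVec₁ (2 : ℝ))) (G h₁)] at h
    rcases hσ with rfl | rfl <;> linarith
  have gVH : ⟪G (triangularVec₂ (2 : ℝ)), G h₁⟫ = 2 * σ := by
    have h := hn2 _ m_h3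
    rw [E6, real_inner_sub_sub_self] at h
    simp only [real_inner_smul_left, real_inner_smul_right] at h
    rw [gHH, gVV, real_inner_comm (G (triangularVec₂ (2 : ℝ))) (G h₁)] at h
    rcases hσ with rfl | rfl <;> linarith
  have s1 : ⟪σ • barlowOffset (2 : ℝ) + layerNormal layerSpacing, σ • barlowOffset (2 : ℝ) + layerNormal layerSpacing⟫ = 4 := by
    simp only [inner_add_left, inner_add_right, real_inner_smul_left, real_inner_smul_right, inner_frameW_frameW,
      inner_frameW_frameE, inner_frameE_frameW, inner_frameE_frameE]
    linear_combination (4 / 3 : ℝ) * hσ2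
  have s2 : ⟪triangularVec₁ (2 : ℝ), σ • barlowOffset (2 : ℝ) + layerNormal layerSpacing⟫ = 2 * σ := by
    simp only [inner_add_right, real_inner_smul_right, inner_frameU_frameW, inner_frameU_frameE]; ring
  have s3 : ⟪triangularVec₂ (2 : ℝ), σ • barlowOffset (2 : ℝ) + layerNormal layerSpacing⟫ = 2 * σ := by
    simp only [inner_add_right, real_inner_smul_right, inner_frameV_frameW, inner_frameV_frameE]; ring
  have hiso : ∀ z, ‖extensionMap σ (G (triangularVec₁ (2 : ℝ))) (G (triangularVec₂ (2 : ℝ))) (G h₁) z‖ = ‖z‖ := by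
    intro z
    have hsq : ‖extensionMap σ (G (triangularVec₁ (2 : ℝ))) (G (triangularVec₂ (2 : ℝ))) (G h₁) z‖ ^ 2 = ‖z‖ ^ 2 := by
      rw [extensionMap_apply, norm_sq_combo, gUU, gVV, gHH, gUV, gUH, gVH]
      conv_rhs => rw [coord_decomp σ z]
      rw [norm_sq_combo, inner_frameU_frameU, inner_frameV_frameV, inner_frameU_frameV, s1, s2, s3]
    rw [← Real.sqrt_sq (norm_nonneg (extensionMap σ _ _ _ z)), hsq, Real.sqrt_sq (norm_nonneg z)]
  refine ⟨{ toLinearMap := extensionMap σ (G (triangularVec₁ (2 : ℝ))) (G (triangularVec₂ (2 : ℝ))) (G h₁), norm_map' := hiso },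
    fun x hx => ?_⟩
  obtain ⟨a, b, c, hxe, hGx⟩ := coeffs x hx
  show G x = extensionMap σ (G (triangularVec₁ (2 : ℝ))) (G (triangularVec₂ (2 : ℝ))) (G h₁) x
  rw [hGx, hxe, hh₁, extensionMap_combo]

/-- ★ **RIGIDITY AT UNIT SCALE, without injectivity (PROVED).** The content of PCR₁ for `108 η₀² < 1`. [this file] -/
theorem barlowShell_relabelling_rigidity {σ τ σ' τ' : ℝ} (hσ : σ = 1 ∨ σ = -1) (hτ : τ = 1 ∨ τ = -1)
    (hσ' : σ' = 1 ∨ σ' = -1) (hτ' : τ' = 1 ∨ τ' = -1)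
    (V : EuclideanSpace ℝ (Fin 3) →ₗᵢ[ℝ] EuclideanSpace ℝ (Fin 3)) (T : EuclideanSpace ℝ (Fin 3) →ₗ[ℝ] EuclideanSpace ℝ (Fin 3))
    (g : EuclideanSpace ℝ (Fin 3) → EuclideanSpace ℝ (Fin 3)) {η₀ : ℝ}
    (hmaps : Set.MapsTo g (barlowShell σ τ) (V '' barlowShell σ' τ'))
    (hclose : ∀ x ∈ barlowShell σ τ, ‖g x - T x‖ ≤ η₀) (hη₀ : 108 * η₀ ^ 2 < 1) :
    ∃ U : EuclideanSpace ℝ (Fin 3) →ₗᵢ[ℝ] EuclideanSpace ℝ (Fin 3), ∀ x ∈ barlowShell σ τ, g x = U x := by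
  -- pass to Hales's scale: `G y = 2 g(y/2)` on `layerShell σ τ = 2 · barlowShell σ τ`
  obtain ⟨G, hG⟩ : ∃ G : EuclideanSpace ℝ (Fin 3) → EuclideanSpace ℝ (Fin 3), ∀ y, G y = (2 : ℝ) • g ((2 : ℝ)⁻¹ • y) :=
    ⟨fun y => (2 : ℝ) • g ((2 : ℝ)⁻¹ • y), fun _ => rfl⟩
  have half_mem : ∀ y ∈ layerShell σ τ, (2 : ℝ)⁻¹ • y ∈ barlowShell σ τ := fun y hy => ⟨y, hy, rfl⟩
  have hmaps' : Set.MapsTo G (layerShell σ τ) (V '' layerShell σ' τ') := by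
    intro y hy
    obtain ⟨y', hy'S, hVy'⟩ := hmaps (half_mem y hy)
    refine ⟨(2 : ℝ) • y', mem_barlowShell_iff.1 hy'S, ?_⟩
    rw [LinearIsometry.map_smul, hVy', hG]
  have hclose' : ∀ y ∈ layerShell σ τ, ‖G y - T y‖ ≤ 2 * η₀ := by
    intro y hy
    have e : G y - T y = (2 : ℝ) • (g ((2 : ℝ)⁻¹ • y) - T ((2 : ℝ)⁻¹ • y)) := by
      rw [hG, map_smul, smul_sub, smul_smul, mul_inv_cancel₀ (two_ne_zero), one_smul]
    rw [e, norm_smul, Real.norm_two]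
    linarith [hclose _ (half_mem y hy)]
  have hη : 27 * (2 * η₀) ^ 2 < 1 := by linarith
  obtain ⟨U, hU⟩ := layerShell_relabelling_rigidity hσ hτ hσ' hτ' V T G hmaps' hclose' hη
  refine ⟨U, fun x hx => ?_⟩
  have h := hU _ (mem_barlowShell_iff.1 hx)
  rw [hG, smul_smul, inv_mul_cancel₀ (two_ne_zero), one_smul, LinearIsometry.map_smul] at h
  exact smul_right_injective _ (two_ne_zero (α := ℝ)) h

/-- ★ **PCR₁ for every `η₀` with `108 η₀² < 1` (PROVED).** [this file] -/
theorem kissingRelabellingRigidity_of_sq_lt {η₀ : ℝ} (hη₀ : 108 * η₀ ^ 2 < 1) : KissingRelabellingRigidity η₀ :=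
  fun _ _ _ _ hσ hτ hσ' hτ' V T g hmaps _ hclose => barlowShell_relabelling_rigidity hσ hτ hσ' hτ' V T g hmaps hclose hη₀

/-- ★★ **PCR₁ `KissingRelabellingRigidity (1/11)` HOLDS (PROVED)** — the typed item of the LAB₁′ engine (`108/121 < 1`). [this file] -/
theorem kissingRelabellingRigidity_eleventh : KissingRelabellingRigidity (1 / 11) :=
  kissingRelabellingRigidity_of_sq_lt (by norm_num)

/-- PCR₁ is monotone in the tolerance. [this file] -/
theorem KissingRelabellingRigidity.mono {η η' : ℝ} (hle : η' ≤ η) (H : KissingRelabellingRigidity η) :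
    KissingRelabellingRigidity η' :=
  fun σ τ σ' τ' hσ hτ hσ' hτ' V T g hmaps hinj hclose =>
    H σ τ σ' τ' hσ hτ hσ' hτ' V T g hmaps hinj fun x hx => (hclose x hx).trans hle

end Summit.AtomisticToContinuum.Crystallization.Theorems.OverbindingBudgetAffineFarSmoothSplit
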